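import Literature.NumberTheory.Rogawski1990.ArchOrbFamGExtFaceJetBoundsOffRealWalls   -- ★ p851268∕p851330 (LH3-p02 (g4)): anisotropic-frame `faceJetBounds`, over ★ `ArchOrbFamGExtFaceJetRelabel` (`faceJetBounds_of_boxDescent(_frame)`) + ★ (H-core) L3 `exists_descent_box_orbFamGExt_inRegG`
import HarnessLib

/-!
# (I₁) at the FACES for the extended genuine orbital families `orbFamGExt ν′ a′` in the NONDEGENERATE diagonal frame (`α_i ≠ 0`, `σ_w(α_i) ∈ ℝ`) — the `hα`-twins of
# the anisotropic-frame face closers of ★ `ArchOrbFamGExtFaceJetRelabel` ∕ ★ `ArchOrbFamGExtFaceJetBoundsOffRealWalls` (Harish-Chandra (I₁) at one-wall points; Bouaziz 1994 §3.1)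

Topic `NumberTheory/Rogawski1990`; namespace `Literature.NumberTheory.Rogawski1990`.  THEOREMS ONLY (no `def`, no instance, no notation, no axiom, no named fact, no
`sorry`); kernel lane `--kind proof --supports stmt-HodgeConjecture-24833`.  Cell `pub/hodgecm-mathlib`, crux H413 (`stmt-HodgeConjecture-24833`); N8 ROAD CENSUS v0
(F0P3a-p02 (g22), fd90e2d340c810dd) §4 CUT B ∕ §5 (1) «`hα`-twins of the L1 closers» (LEAD F0P3a-plan (g14) T13-42 priority item (5); co-hand split 14:06:39Z: CROSS +
MIXED ↦ F0P3a-p02 (g22), JUMP ∕ FACES ∕ CENTRAL ∕ HEAD ↦ LH10-p02 (g8)).  Author LH10-p02 (g8).  Companion: ★∕filed `ArchOrbFamGExtJumpNondeg` (the (I₃) chain).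

WHY (as in the companion).  The `stub_N9` leaf's letter L1 and its ★ frame-form closers carry the anisotropy binder `hanis` of the inner form `G′ = U(diag α)`; the proofs
read it only as `hα : ∀ i, α i ≠ 0 := ne_zero_of_diagonal_anisotropic hanis`, every engine below being stated for the nondegenerate real diagonal frame (`hα`, `hreal`).
The quasi-split `G_∞ = U(Φ₃)_∞` is the same atlas at the ISOTROPIC frame `β = (½, 1, −½)` (`hherm` ✓, `hα` ✓, `hanis` ✗), so a `G`-side road (rows 2∕4∕5) imports the L1
theory through these twins.  This file: the FACE stratum of (I₁) — `faceJetBounds_of_boxDescent_frame_of_ne_zero` (twin of ★ `faceJetBounds_of_boxDescent_frame`, LH3-p02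
(g4) ED. 2) and the hypothesis-free `faceJetBounds_of_ne_zero` (twin of ★ `faceJetBounds`, ED. 4, over ★ (H-core) L3 `exists_descent_box_orbFamGExt_inRegG`, LH5-p02 (g4)),
whose conclusion is the `hF` callback of ★ `smoothBounded_orbFamGExt_of_strata₄` token for token.  PROOFS = the ★ bodies VERBATIM with `hanis` ↦ `hα` (the `have hα` line
deleted); statements = the ★ statements but for that binder; names = ★ names + `_of_ne_zero`.  The ED.-3 halves (`…_offRealWalls`, `…_onRealWall(_of_boxDescentOn)`,
`…_of_boxDescent_frame₂`, `…_of_boxDescentOn`) are not twinned: since ED. 4 the whole face socket is paid by `faceJetBounds` in one stroke.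
HONEST LABEL: count-neutral (no leaf, no letter, no books row; LH2 «§4 NO» unchanged); HC_CM is proved only modulo the 7 printed citations (2 remaining: hLiu418 =
`stmt-HodgeConjecture-24832`, h413 = `stmt-HodgeConjecture-24833`) until rung 0 closes.

## References
* [Varadarajan1977] V. S. Varadarajan, *Harmonic Analysis on Real Reductive Groups*, LNM 576 (1977), Part I §1.12.
* [Shelstad1979] D. Shelstad, *Characters and inner forms of a quasi-split group over ℝ*, Compositio Math. 39 (1979), §4 pp. 22–25.
* [Bouaziz1994IntegralesOrbitales] A. Bouaziz, *Intégrales orbitales sur les groupes de Lie réductifs*, Ann. Sci. ÉNS 27 (1994), §3.1 (I₁)–(I₂) p. 579, §3.2 p. 580.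
* [Rogawski1990] J. D. Rogawski, *Automorphic Representations of Unitary Groups in Three Variables*, Ann. of Math. Stud. 123 (1990), §8.2 pp. 118–124.
-/

set_option autoImplicit false

noncomputable section

open Set Filter Topology Function MeasureTheory NumberField NumberField.InfinitePlace Complex Equiv
open scoped ContDiff MatrixGroups Matrix Classical Real Matrix.Norms.Operator

namespace Literature.NumberTheory.Rogawski1990

open Literature.NumberTheory.Automorphic Literature.NumberTheory.Automorphic.UnitaryGroup Literature.NumberTheory.Automorphic.ArchCartan
open Literature.Analysis.Calculus

variable (L : Type) [Field L] [NumberField L] [IsCMField L] (α : Fin 3 → L)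
  [MeasurableSpace ↥(arch (↥(maximalRealSubfield L)) L (IsCMField.complexConj L) 3 (Matrix.diagonal α))]
  [BorelSpace ↥(arch (↥(maximalRealSubfield L)) L (IsCMField.complexConj L) 3 (Matrix.diagonal α))]
  (ν' : Measure ↥(arch (↥(maximalRealSubfield L)) L (IsCMField.complexConj L) 3 (Matrix.diagonal α))) [ν'.IsHaarMeasure] [ν'.IsMulRightInvariant]

/-! ## §1 O-L1c `hF` from the (B-desc′) head, nondegenerate frame -/


/-- **O-L1c `hF` IN THE LEAF'S SHAPE FROM THE (B-desc′) HEAD ALONE — NONDEGENERATE-FRAME TWIN of ★ `faceJetBounds_of_boxDescent_frame`** (`Literature/NumberTheory/Rogawski1990/ArchOrbFamGExtFaceJetRelabel.lean`): the same statement with the anisotropy binder `hanis` replaced by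
`hα : ∀ i, α i ≠ 0`; proof = the ★ body verbatim (the line `have hα := ne_zero_of_diagonal_anisotropic hanis` deleted). [cite: Varadarajan1977, Part I §1.12] [cite: Bouaziz1994IntegralesOrbitales, §3.1 (I₁)–(I₂) p. 579; §3.2 p. 580] [cite: Shelstad1979, §4 pp. 22–25] [cite: Rogawski1990, §8.2 pp. 118–124] -/
theorem faceJetBounds_of_boxDescent_frame_of_ne_zero
    (hherm : ((Matrix.diagonal α).map (cmConjRingHom L)).transpose = Matrix.diagonal α)
    (hα : ∀ i, α i ≠ 0)
    {a' : ↥(arch (↥(maximalRealSubfield L)) L (IsCMField.complexConj L) 3 (Matrix.diagonal α)) → ℂ} (ha' : ArchSmooth L 3 (Matrix.diagonal α) a')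
    (hbox : ∀ {J : Matrix (Fin 2) (Fin 2) ℂ} (hJ : J = (StdForm.antidiagonal 2).over ℂ)
      [MeasurableSpace ↥(unitaryGroupOfForm (starRingEnd ℂ) J)] [BorelSpace ↥(unitaryGroupOfForm (starRingEnd ℂ) J)] [LocallyCompactSpace ↥(unitaryGroupOfForm (starRingEnd ℂ) J)] [SecondCountableTopology ↥(unitaryGroupOfForm (starRingEnd ℂ) J)]
      (μ₀ : Measure ↥(unitaryGroupOfForm (starRingEnd ℂ) J)) [μ₀.IsHaarMeasure] [μ₀.IsMulRightInvariant],
      ∀ (S : Finset {w : InfinitePlace L // IsComplex w}), (∀ w, w ∈ S → w ∈ splitChartPlaces L α) → ∀ (w₀ : {w : InfinitePlace L // IsComplex w}), w₀ ∉ S → w₀ ∈ splitChartPlaces L α →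
      ∀ (x : {w : InfinitePlace L // IsComplex w} → Fin 3 → ℝ), x w₀ 0 = x w₀ 2 → Circle.exp (x w₀ 1) ≠ Circle.exp (x w₀ 0) →
      (∀ w', w' ∉ S → w' ≠ w₀ → ∀ i' j' : Fin 3, i' ≠ j' → slotSign L α w' i' ≠ slotSign L α w' j' → Circle.exp (x w' i') ≠ Circle.exp (x w' j')) →
      ∃ (K : ℂ) (U : Set ({w : InfinitePlace L // IsComplex w} → Fin 3 → ℝ)) (f : ({w : InfinitePlace L // IsComplex w} → Fin 3 → ℝ) × Matrix (Fin 2) (Fin 2) ℂ → ℂ),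
      K ≠ 0 ∧ IsOpen U ∧ x ∈ U ∧ ContDiff ℝ ∞ f ∧
      (∃ C : Set (Matrix (Fin 2) (Fin 2) ℂ), IsCompact C ∧ ∀ c X, X ∉ C → f (c, X) = 0) ∧
      (∀ c X, f (c, X) = f (Function.update c w₀ ![0, c w₀ 1, 0], X)) ∧
      (∀ c ∈ U, Circle.exp (c w₀ 0) ≠ Circle.exp (c w₀ 2) → c ∈ InRegG (slotSign L α) S) ∧
      ∀ c ∈ U, Circle.exp (c w₀ 0) ≠ Circle.exp (c w₀ 2) →
        orbFamGExt L α ν' a' S c =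
          (1 - (Circle.exp (c w₀ 1 - c w₀ 0) : ℂ)) * (1 - (Circle.exp (c w₀ 2 - c w₀ 0) : ℂ)) * (1 - (Circle.exp (c w₀ 2 - c w₀ 1) : ℂ)) *
          (K * ∫ h : ↥(unitaryGroupOfForm (starRingEnd ℂ) J),
            f (c, (((h * ⟨Matrix.GeneralLinearGroup.mkOfDetNeZero !![(1 : ℂ), 1; 1, -1] det_cayleyTwo_ne_zero *
                  circleDiagonal 2 ![Circle.exp (c w₀ 0), Circle.exp (c w₀ 2)] *
                  (Matrix.GeneralLinearGroup.mkOfDetNeZero !![(1 : ℂ), 1; 1, -1] det_cayleyTwo_ne_zero)⁻¹,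
                cayley_conj_circleDiagonal_mem_of_eq_over hJ _⟩ * h⁻¹ : ↥(unitaryGroupOfForm (starRingEnd ℂ) J)) : GL (Fin 2) ℂ) : Matrix (Fin 2) (Fin 2) ℂ)) ∂μ₀)) :
    ∀ (S' : Finset {w : InfinitePlace L // IsComplex w}) (n : ℕ) (x : {w : InfinitePlace L // IsComplex w} → Fin 3 → ℝ) (w : {w : InfinitePlace L // IsComplex w}) (i j : Fin 3),
      (∀ w' : {w : InfinitePlace L // IsComplex w}, w' ∉ S' → ∀ l : Fin 3, x w' l ∈ Ico 0 (2 * π)) →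
      w ∉ S' → i ≠ j → slotSign L α w i ≠ slotSign L α w j → x w i = x w j →
        Circle.exp (x w (hcThird i j)) ≠ Circle.exp (x w i) →
        (∀ w', w' ∉ S' → w' ≠ w → ∀ i' j' : Fin 3, i' ≠ j' → slotSign L α w' i' ≠ slotSign L α w' j' → Circle.exp (x w' i') ≠ Circle.exp (x w' j')) →
        ∃ U ∈ 𝓝 x, BddAbove ((fun c => ‖iteratedFDeriv ℝ n (orbFamGExt L α ν' a' S') c‖) '' (U ∩ InRegG (slotSign L α) S')) := by
  -- the frame
  have hreal : ∀ (w' : {w : InfinitePlace L // IsComplex w}) (i : Fin 3), (w'.1.embedding (α i)).im = 0 :=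
    im_embedding_diagonal_eq_zero L 3 α (complexConj_apply_eq_of_diagonal_frame hherm)
  -- the standard rank-one Cayley carrier `U(J)` with a two-sided Haar measure
  obtain ⟨J, hJ⟩ : ∃ J : Matrix (Fin 2) (Fin 2) ℂ, J = (StdForm.antidiagonal 2).over ℂ := ⟨_, rfl⟩
  letI : MeasurableSpace ↥(unitaryGroupOfForm (starRingEnd ℂ) J) := borel _
  haveI : BorelSpace ↥(unitaryGroupOfForm (starRingEnd ℂ) J) := ⟨rfl⟩
  haveI : LocallyCompactSpace ↥(unitaryGroupOfForm (starRingEnd ℂ) J) := locallyCompactSpace_unitaryGroupOfForm_complex J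
  haveI : SecondCountableTopology ↥(unitaryGroupOfForm (starRingEnd ℂ) J) := secondCountableTopology_unitaryGroupOfForm_complex J
  letI : MeasurableSpace (↥(unitaryGroupOfForm (starRingEnd ℂ) J) ⧸ torusU (starRingEnd ℂ) J) := borel _
  haveI : BorelSpace (↥(unitaryGroupOfForm (starRingEnd ℂ) J) ⧸ torusU (starRingEnd ℂ) J) := ⟨rfl⟩
  obtain ⟨μ₀, hμ₀H, hμ₀R, -⟩ := sharedRankOneDatum_exists hJ
  haveI := hμ₀H
  haveI := hμ₀R
  exact faceJetBounds_of_boxDescent L α ν' hα hreal hJ μ₀ ha' (hbox hJ μ₀)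

/-! ## §2 (I₁) at the faces, hypothesis-free, nondegenerate frame -/


/-- **(I₁) AT THE FACES — HYPOTHESIS-FREE (the `hF` socket of ★ `smoothBounded_orbFamGExt_of_strata₄`) — NONDEGENERATE-FRAME TWIN of ★ `faceJetBounds`** (`Literature/NumberTheory/Rogawski1990/ArchOrbFamGExtFaceJetBoundsOffRealWalls.lean`): the same statement with the anisotropy binder `hanis` replaced by
`hα : ∀ i, α i ≠ 0`; proof = the ★ body verbatim (the line `have hα := ne_zero_of_diagonal_anisotropic hanis` deleted). [cite: Varadarajan1977, Part I §1.12] [cite: Bouaziz1994IntegralesOrbitales, §3.1 (I₁)–(I₂) p. 579; §3.2 p. 580] [cite: Shelstad1979, §4 pp. 22–25] [cite: Rogawski1990, §8.2 pp. 118–124] -/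
theorem faceJetBounds_of_ne_zero
    (hherm : ((Matrix.diagonal α).map (cmConjRingHom L)).transpose = Matrix.diagonal α)
    (hα : ∀ i, α i ≠ 0)
    {a' : ↥(arch (↥(maximalRealSubfield L)) L (IsCMField.complexConj L) 3 (Matrix.diagonal α)) → ℂ} (ha' : ArchSmooth L 3 (Matrix.diagonal α) a') :
    ∀ (S' : Finset {w : InfinitePlace L // IsComplex w}) (n : ℕ) (x : {w : InfinitePlace L // IsComplex w} → Fin 3 → ℝ) (w : {w : InfinitePlace L // IsComplex w}) (i j : Fin 3),
      (∀ w' : {w : InfinitePlace L // IsComplex w}, w' ∉ S' → ∀ l : Fin 3, x w' l ∈ Ico 0 (2 * π)) →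
      w ∉ S' → i ≠ j → slotSign L α w i ≠ slotSign L α w j → x w i = x w j →
        Circle.exp (x w (hcThird i j)) ≠ Circle.exp (x w i) →
        (∀ w', w' ∉ S' → w' ≠ w → ∀ i' j' : Fin 3, i' ≠ j' → slotSign L α w' i' ≠ slotSign L α w' j' → Circle.exp (x w' i') ≠ Circle.exp (x w' j')) →
        ∃ U ∈ 𝓝 x, BddAbove ((fun c => ‖iteratedFDeriv ℝ n (orbFamGExt L α ν' a' S') c‖) '' (U ∩ InRegG (slotSign L α) S')) := by
  have hreal : ∀ (w' : {w : InfinitePlace L // IsComplex w}) (i : Fin 3), (w'.1.embedding (α i)).im = 0 :=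
    im_embedding_diagonal_eq_zero L 3 α (complexConj_apply_eq_of_diagonal_frame hherm)
  refine faceJetBounds_of_boxDescent_frame_of_ne_zero L α ν' hherm hα ha' ?_
  intro J hJ _ _ _ _ μ₀ _ _ S hS w₀ hw₀ hwsp x hx02 hx1 hxin
  exact exists_descent_box_orbFamGExt_inRegG L α ν' hα hreal hJ μ₀ hS hw₀ hwsp hx02 hx1 hxin ha'
/-- **O-L1c-b «FACE × A REAL WALL» — HYPOTHESIS-FREE (the leaf v6 half, extra clause dropped) — NONDEGENERATE-FRAME TWIN of ★ `faceJetBounds_onRealWall`** (`Literature/NumberTheory/Rogawski1990/ArchOrbFamGExtFaceJetBoundsOffRealWalls.lean`): the same statement with the anisotropy binder `hanis` replaced by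
`hα : ∀ i, α i ≠ 0`; proof = the ★ body verbatim (the line `have hα := ne_zero_of_diagonal_anisotropic hanis` deleted). [cite: Varadarajan1977, Part I §1.12] [cite: Bouaziz1994IntegralesOrbitales, §3.1 (I₁)–(I₂) p. 579; §3.2 p. 580] [cite: Shelstad1979, §4 pp. 22–25] [cite: Rogawski1990, §8.2 pp. 118–124] -/
theorem faceJetBounds_onRealWall_of_ne_zero
    (hherm : ((Matrix.diagonal α).map (cmConjRingHom L)).transpose = Matrix.diagonal α)
    (hα : ∀ i, α i ≠ 0)
    {a' : ↥(arch (↥(maximalRealSubfield L)) L (IsCMField.complexConj L) 3 (Matrix.diagonal α)) → ℂ} (ha' : ArchSmooth L 3 (Matrix.diagonal α) a') :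
    ∀ (S' : Finset {w : InfinitePlace L // IsComplex w}) (n : ℕ) (x : {w : InfinitePlace L // IsComplex w} → Fin 3 → ℝ) (w : {w : InfinitePlace L // IsComplex w}) (i j : Fin 3),
      (∀ w' : {w : InfinitePlace L // IsComplex w}, w' ∉ S' → ∀ l : Fin 3, x w' l ∈ Ico 0 (2 * π)) →
      w ∉ S' → i ≠ j → slotSign L α w i ≠ slotSign L α w j → x w i = x w j →
        Circle.exp (x w (hcThird i j)) ≠ Circle.exp (x w i) →
        (∀ w', w' ∉ S' → w' ≠ w → ∀ i' j' : Fin 3, i' ≠ j' → slotSign L α w' i' ≠ slotSign L α w' j' → Circle.exp (x w' i') ≠ Circle.exp (x w' j')) →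
        (∃ w' : {w : InfinitePlace L // IsComplex w}, w' ∈ S' ∧ x w' 0 = 0) →
        ∃ U ∈ 𝓝 x, BddAbove ((fun c => ‖iteratedFDeriv ℝ n (orbFamGExt L α ν' a' S') c‖) '' (U ∩ InRegG (slotSign L α) S')) :=
  fun S' n x w i j hcube hw hij hs hx hxk hxin _ => faceJetBounds_of_ne_zero L α ν' hherm hα ha' S' n x w i j hcube hw hij hs hx hxk hxin

end Literature.NumberTheory.Rogawski1990

end

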